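import Summits.QuantumFields.YangMills.Theorems.UnitScaleTiltFluctuationComparisonRegPrGlobalSlackCanonicalPolymersJetStep
import HarnessLib

/-!
# `UnitScaleTiltFluctuationComparisonRegPrGlobalSlackCanonicalPolymersLambdaStep` — THE Λ-FAMILY (G3D-07) NEWBORN TWO-RUN ROW AT THE COLLAR PROFILE `p₀ + r₀` FROM K1a FOR THE
# Λ-KERNELS AND THE CONFIGURATION CAUCHY ROW; THE Λ FAR TERMS DISCHARGED FROM THE DISPLAYED G3D-06 ROW (crux `FluctuationComparisonRegPrIntL`, stmt-QuantumFields-20520,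
# skeleton v5kC STUBS 3⁗χ / (i*)χ; lane B seat ym-ust-19935-r1 g5, continuing ym-ust-20520-w2 g0's newborn-row programme)

WHY.  After `…CanonicalPolymersJetStep` (p591487) the newborn two-run row of (i*)χ/3⁗χ is, by name, `JetStepSlackOn` (a THEOREM of K1a for the displayed Ψ-kernels and the
configuration Cauchy row) plus w2 g0's LOCATED RESIDUAL `LambdaTermSlackOn` — the g-free Λ-family of (61)–(63), whose displayed sizes (`(𝔄.Λc k).far_le`: `g⁷(r(g)p(g))⁷`;
`bound28`'s `r(g)` inside the g-free jet) carry the (28)-collar polylogarithm with NO spare coupling, hence do not fit the record-profile currency `θ_{b₀,p₀}` with an `n`-uniform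
constant (w2: «needs the two-profile door … or an order-8/spare-g Λ display — owner's call»).  With ★r1 g5's doors in the tree (`…GlobalSlackTwoProfile` p589354,
`…GlobalSlackHigherProfile` p589812: the slack row at ANY higher log-profile closes the crux at the record's profile) the polylogarithm is simply a PROFILE SHIFT:
`r(g)·g·p_{p₀}(g) = g·p_{p₀+r₀}(g)`, i.e. `cB·(r g p) = cB·θ_{b₀,p₀+r₀}(n+1)` and `g⁷(r p)⁷ = θ_{b₀,p₀+r₀}(n+1)⁷`.  This file proves the Λ-row AT THE COLLAR PROFILE:

* §L1 `lambdaChartAt` (the displayed Λ-chart `(𝔄.Λc k).Ψ X` in the family's bond coordinates), **`K1aStepΛ q κ₁ a C`** (hypothesis schema: King's two-run flat-kernel comparison for the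
  Λ-charts, configuration-free), `norm_kernelΛ_le_of_chart` (g-free kernel sizes `C63·(max 1 (12/ρ))⁶·e^{−κ·dj}` from `(𝔄.Λc k).chart`);
* §L2 `abs_farΛ_le` / `_succ_le` / **`abs_farΛ_sub_le`**: the Λ far terms of one run, of the other run at the transported domain, and their two-run difference are
  `Cfar·C63·e^{−κ·dj}·θ_{b₀,p₀+r₀}(·)⁷`-small — a THEOREM of the displayed `(𝔄.Λc k).far_le` of both runs (w1 g0's hypothesis row (F^Λ) `LambdaFarSmallOwn`, at the collar profile);
* §L3 **`lambdaTermSlackOn_of_k1aΛ_cfgCauchy`** : `K1aStepΛ q κ₁ a C → CfgCauchyStepOn S q 𝔠.b₀ (𝔠.p₀+𝔠.r₀) a C_B →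
  LambdaTermSlackOn S q 𝔠.b₀ (𝔠.p₀+𝔠.r₀) κ₁ (θ_{𝔠.b₀,𝔠.p₀+𝔠.r₀}²) a 7 (5·(cB²·C + 6·cB·C_B·C63·(max 1 (12/ρ))⁶) + 2·Cfar·C63)` — the jet part by `jet_re_diff_ml_transport` (p591487's
  seam-free form of lane A's algebra) at the displayed objects, the far part by §L2; NO order trade, NO spare coupling, shift `0`.
UPSHOT, BY NAME: in the collar-profile currency the whole NEWBORN two-run row of (i*)χ/3⁗χ is a theorem of {`K1aStepΨ`, `K1aStepΛ`, `CfgCauchyStepOn`} — King's two number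
comparisons for the displayed Ψ- and Λ-kernels and the 19200-side configuration comparison — and the crux reads that currency through `regPrIntL_of_recChi_slackOnChi_higherProfile_allL`.
The OLD-level row `OldTermSlackOn` ((M1)) is untouched.  Nothing of [Balaban1985UV3]/[King1986] is asserted; no numerics; registry untouched (`--supports stmt-QuantumFields-20520`).
YM₃ on the torus is a rung of the ladder, not the Clay problem; nothing here is a claim about the crux or the gap.

References: C. King, CMP 102 (1986) 649–677 [King1986] (Prop. 3.6 (3.55)–(3.56) p.662, Prop. 3.8 (3.71) p.664, Thm 3.4 (3.9) p.656); T. Bałaban, CMP 102 (1985) 255–275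
[Balaban1985UV3] ((7) p.257, (25) p.262, (28) p.263, (33)–(34) p.264, p.265 L13–15, (57) p.270, (61)–(63) pp.271–272); S. B. Chae, Holomorphy and Calculus in Normed Spaces (1985)
[Chae1985] (13.6).
-/

set_option autoImplicit false

noncomputable section

namespace Summit.QuantumFields.YangMills.Theorems.GlobalSlackCanonicalPolymers

open scoped BigOperators
open Finset
open Literature.MathematicalPhysics.QuantumFieldTheory.Balaban1983to89
open Literature.MathematicalPhysics.QuantumFieldTheory.Balaban1983to89.T3ContinuumYM3Torus
open Literature.MathematicalPhysics.QuantumFieldTheory.Balaban1983to89.T3UnitScaleTilt (θBal)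
open Literature.MathematicalPhysics.QuantumFieldTheory.Balaban1983to89.T3LevelShift (fieldShift)
open Literature.MathematicalPhysics.QuantumFieldTheory.Balaban1983to89.T3Thresholds (θBal_succ_le)
open Literature.MathematicalPhysics.QuantumFieldTheory.Balaban1983to89.T3AlphaInputsAC
open Literature.MathematicalPhysics.QuantumFieldTheory.Balaban1983to89.T3AlphaPolymerSocket
open Literature.MathematicalPhysics.QuantumFieldTheory.Balaban1983to89.T3AlphaInputsACTwoRunLevel
open Literature.MathematicalPhysics.QuantumFieldTheory.Balaban1983to89.TreeLengthTorus (tsys TPt)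
open Literature.MathematicalPhysics.QuantumFieldTheory.Balaban1985CMP102
open Literature.MathematicalPhysics.QuantumFieldTheory.Balaban1985CMP102.Setting
open Literature.MathematicalPhysics.QuantumFieldTheory.Balaban1985CMP102.Binders (ChartAnalyticityAsCited)
open Summit.QuantumFields.Balaban3D.Carriers
open Summit.QuantumFields.Balaban3D.Proofs.Primitives
open Summit.QuantumFields.Balaban3D.Proofs.GroupModelLieC (lieC)
open Summit.QuantumFields.Balaban3D.Proofs.Representation33 (jet26)
open Summit.QuantumFields.Balaban3D.Proofs.NewbornJet (rFun_pow)
open Summit.QuantumFields.Balaban3D.Proofs.ScalesArithmetic (gk_pos gk_le_one)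
open Summit.QuantumFields.YangMills.Theorems
open Summit.QuantumFields.YangMills.Theorems.GlobalSlackKernelMatching
open Summit.QuantumFields.YangMills.Theorems.GlobalSlackKernelMatchingOn (WinPred)

variable {F : T3Family} {𝔠 : AlphaConsts F.L (suGroupModel 2).N} {γ : ℝ} {hγ : 0 < γ} {hγ1 : γ ≤ (min 𝔠.gamma0 1) ^ 2}

/-! ## §L1 The Λ-family step charts in the family's bond coordinates, their displayed sizes, and the K1a row for them -/

/-- **THE DISPLAYED Λ-FAMILY STEP CHART OF RUN `K` AT STEP `k` AND DOMAIN `X`, IN THE FAMILY'S BOND COORDINATES** (`(𝔄.Λc k).Ψ X`, the localized (63)-pieces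
of G3D-07; the chart space `PBond (T3Scales …).P k → 𝔤ᶜ` IS `PBond (F.P K) k → 𝔤ᶜ`). [cite: Balaban1985UV3, (61)-(63) pp.271-272, p.265 L13-15] -/
def lambdaChartAt (q : ∀ K, AlphaInputsT3AC.PkgCoreV3 F 𝔠 γ hγ hγ1 K) (K k : ℕ) (X : (tsys 3 (nblkOf (SK F 𝔠 γ hγ hγ1 K) 𝔠.lane.carrier k)).Dom) :
    (PBond (F.P K) k → ↥(lieC (suGroupModel 2))) → ℂ :=
  ((q K).𝔄.Λc k).Ψ X

/-- **K1a FOR THE DISPLAYED Λ-FAMILY STEP CHARTS** (hypothesis schema, never asserted) — the two-run number comparison of [King1986] Prop. 3.6 (3.56) for the g-FREE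
(63)-pieces: for every retained domain `X` of step `k` of run `K` and every order `2 ≤ d ≤ 6`, run `K+1`'s step-`(k+1)` flat Λ-kernel at the transported domain, pulled back along the
bond transport, and run `K`'s step-`k` flat Λ-kernel at `X` differ in operator norm by `C·e^{−κ₁·dj X}·L^{−a(1+k)}`.  Configuration-free.
[cite: King1986, Prop. 3.6 (3.56) p.662; Balaban1985UV3, (61)-(63) pp.271-272] -/
def K1aStepΛ (q : ∀ K, AlphaInputsT3AC.PkgCoreV3 F 𝔠 γ hγ hγ1 K) (κ₁ a C : ℝ) : Prop :=
  ∀ (K k : ℕ) (hk : k + 1 ≤ K), ∀ X ∈ newDomsCore q K k (Hist.triv (F.P K) (k + 1)), ∀ d ∈ Finset.Ico 2 7,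
    ‖(iteratedFDeriv ℂ d (lambdaChartAt q (K + 1) (k + 1) (domCast (nblkOf_succ_eq (hγ := hγ) (hγ1 := hγ1) K k) X)) 0).compContinuousLinearMap
          (fun _ => transport ↥(lieC (suGroupModel 2)) F K k) -
        iteratedFDeriv ℂ d (lambdaChartAt q K k X) 0‖ ≤
      C * Real.exp (-κ₁ * (tsys 3 (nblkOf (SK F 𝔠 γ hγ hγ1 K) 𝔠.lane.carrier k)).dj X) * (((F.L : ℝ) ^ (1 + k))⁻¹) ^ a

/-- **Λ-KERNEL SIZES FROM THE DISPLAYED G3D-07 CHART ROW, g-FREE** (`(𝔄.Λc k).chart X` + the operator-norm Cauchy inequality): `‖Dᵈ(Λ^K_{k,X})(0)‖ ≤ C63·(max 1 (12/ρ))⁶·e^{−κ·dj X}` for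
`d ≤ 6`. [cite: Balaban1985UV3, (25) p.262, p.265 L13-15, Prop. 3 (34) p.264; Chae1985, 13.6] -/
theorem norm_kernelΛ_le_of_chart (q : ∀ K, AlphaInputsT3AC.PkgCoreV3 F 𝔠 γ hγ hγ1 K) (K k : ℕ)
    (X : (tsys 3 (nblkOf (SK F 𝔠 γ hγ hγ1 K) 𝔠.lane.carrier k)).Dom) {d : ℕ} (hd : d ≤ 6) :
    ‖iteratedFDeriv ℂ d (lambdaChartAt q K k X) 0‖ ≤
      𝔠.C63 * (max 1 (12 / 𝔠.ρ)) ^ 6 * Real.exp (-(𝔠.κ * (tsys 3 (nblkOf (SK F 𝔠 γ hγ hγ1 K) 𝔠.lane.carrier k)).dj X)) := by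
  have h := norm_iteratedFDeriv_zero_le_uniform (((q K).𝔄.Λc k).chart X) hd
  calc ‖iteratedFDeriv ℂ d (lambdaChartAt q K k X) 0‖
      ≤ 𝔠.C63 * Real.exp (-(𝔠.κ * (tsys 3 (nblkOf (SK F 𝔠 γ hγ hγ1 K) 𝔠.lane.carrier k)).dj X)) * (max 1 (12 / 𝔠.ρ)) ^ 6 := h
    _ = _ := by ring

/-! ## §L2 The Λ-family far terms at the collar profile `p₀ + r₀`: one run, the other run, the two-run difference -/

/-- **ONE RUN: THE Λ-FAMILY FAR TERMS ARE SEVENTH-ORDER SMALL AT THE COLLAR PROFILE `p₀ + r₀`** — from the displayed G3D-06 row `(𝔄.Λc k).far_le`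
(`|farΛ_X(h,U)| ≤ Cfar·(C63·e^{−κ·dj X})·g_k⁷(r(g_k)p(g_k))⁷`) and the identity `r(g)·g·p_{p₀}(g) = g·p_{p₀+r₀}(g)` (`rFun_mul_mul_pFun`): `|farΛ_X(triv, W)| ≤
Cfar·C63·e^{−κ·dj X}·θ_{b₀,p₀+r₀}(K − k)⁷` — the g-free family has no spare coupling, so its polylogarithm stays as a PROFILE SHIFT (★r1 g5 `θBal_mul_xlog_rpow`), to be passed
through the higher-profile door. [cite: Balaban1985UV3, (61)-(63) pp.271-272, p.264 L15-16, (7) p.257] -/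
theorem abs_farΛ_le (q : ∀ K, AlphaInputsT3AC.PkgCoreV3 F 𝔠 γ hγ hγ1 K) (K k : ℕ) (hk : k + 1 ≤ K)
    (X : (tsys 3 (nblkOf (SK F 𝔠 γ hγ hγ1 K) 𝔠.lane.carrier k)).Dom) (W : GaugeField (F.P K) (k + 1) (Matrix.specialUnitaryGroup (Fin 2) ℂ)) :
    |((q K).𝔄.Λc k).far X (Hist.triv (F.P K) (k + 1)) W| ≤
      𝔠.Cfar * 𝔠.C63 * Real.exp (-(𝔠.κ * (tsys 3 (nblkOf (SK F 𝔠 γ hγ hγ1 K) 𝔠.lane.carrier k)).dj X)) *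
        θBal F.L γ 𝔠.b₀ (𝔠.p₀ + 𝔠.r₀) (K - k) ^ 7 := by
  set g : ℝ := (SK F 𝔠 γ hγ hγ1 K).gk k with hgdef
  set e : ℝ := Real.exp (-(𝔠.κ * (tsys 3 (nblkOf (SK F 𝔠 γ hγ hγ1 K) 𝔠.lane.carrier k)).dj X)) with hedef
  have hg0 : 0 < g := gk_pos _ k
  have hg1 : g ≤ 1 := gk_le_one _ (SK F 𝔠 γ hγ hγ1 K).gK_le_one k (by show k ≤ K; omega)
  have hfar : |((q K).𝔄.Λc k).far X (Hist.triv (F.P K) (k + 1)) W| ≤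
      𝔠.Cfar * ((𝔠.C63 * e) * (g ^ 7 * (B10.rFun 𝔠.r₀ g * B10.pFun 𝔠.b₀ 𝔠.p₀ g) ^ 7)) :=
    ((q K).𝔄.Λc k).far_le X (Hist.triv (F.P K) (k + 1)) W
  have hid : g * (B10.rFun 𝔠.r₀ g * B10.pFun 𝔠.b₀ 𝔠.p₀ g) = θBal F.L γ 𝔠.b₀ (𝔠.p₀ + 𝔠.r₀) (K - k) := by
    rw [show g * (B10.rFun 𝔠.r₀ g * B10.pFun 𝔠.b₀ 𝔠.p₀ g) = B10.rFun 𝔠.r₀ g * g * B10.pFun 𝔠.b₀ 𝔠.p₀ g by ring, rFun_mul_mul_pFun hg0 hg1,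
      hgdef, SK, T3Scales_gk_eq F γ hγ _ K k (by omega), ← T3Thresholds.θBal_eq]
  calc |((q K).𝔄.Λc k).far X (Hist.triv (F.P K) (k + 1)) W|
      ≤ 𝔠.Cfar * ((𝔠.C63 * e) * (g ^ 7 * (B10.rFun 𝔠.r₀ g * B10.pFun 𝔠.b₀ 𝔠.p₀ g) ^ 7)) := hfar
    _ = 𝔠.Cfar * 𝔠.C63 * e * (g * (B10.rFun 𝔠.r₀ g * B10.pFun 𝔠.b₀ 𝔠.p₀ g)) ^ 7 := by ring
    _ = _ := by rw [hid]

/-- **THE OTHER RUN AT THE TRANSPORTED DOMAIN, SAME BOUND** (`gk_succ_eq`, `dj_domCast`, `(K+1) − (k+1) = K − k`). [cite: Balaban1985UV3, (61)-(63) pp.271-272, (39) p.266] -/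
theorem abs_farΛ_succ_le (q : ∀ K, AlphaInputsT3AC.PkgCoreV3 F 𝔠 γ hγ hγ1 K) (K k : ℕ) (hk : k + 1 ≤ K)
    (X : (tsys 3 (nblkOf (SK F 𝔠 γ hγ hγ1 K) 𝔠.lane.carrier k)).Dom) (W' : GaugeField (F.P (K + 1)) (k + 1 + 1) (Matrix.specialUnitaryGroup (Fin 2) ℂ)) :
    |((q (K + 1)).𝔄.Λc (k + 1)).far (domCast (nblkOf_succ_eq (hγ := hγ) (hγ1 := hγ1) K k) X) (Hist.triv (F.P (K + 1)) (k + 1 + 1)) W'| ≤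
      𝔠.Cfar * 𝔠.C63 * Real.exp (-(𝔠.κ * (tsys 3 (nblkOf (SK F 𝔠 γ hγ hγ1 K) 𝔠.lane.carrier k)).dj X)) *
        θBal F.L γ 𝔠.b₀ (𝔠.p₀ + 𝔠.r₀) (K - k) ^ 7 := by
  have h := abs_farΛ_le q (K + 1) (k + 1) (by omega) (domCast (nblkOf_succ_eq (hγ := hγ) (hγ1 := hγ1) K k) X) W'
  rw [dj_domCast, show K + 1 - (k + 1) = K - k by omega] at h
  exact h

/-- **THE TWO-RUN DIFFERENCE OF THE Λ-FAMILY FAR TERMS IS `θ_{p₀+r₀}(n)⁷`-SLACK** (height `n`, `K − k = n + 1`; rate `κ₁ ≤ κ`; `√γ ≤ e^{1−(p₀+r₀)}` so that `θ_{p₀+r₀}(n+1) ≤ θ_{p₀+r₀}(n)`):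
`|farΛ′ − farΛ| ≤ 2·Cfar·C63·e^{−κ₁·dj X}·θ_{b₀,p₀+r₀}(n)⁷` — a theorem of the two runs' displayed G3D-06 rows for the (63)-pieces; no comparison of far terms is claimed.
[cite: Balaban1985UV3, (57) p.270, (61)-(63) pp.271-272, (7) p.257; King1986, Thm 3.4 (3.9) p.656] -/
theorem abs_farΛ_sub_le (q : ∀ K, AlphaInputsT3AC.PkgCoreV3 F 𝔠 γ hγ hγ1 K) {κ₁ : ℝ} (hκ₁ : κ₁ ≤ 𝔠.κ)
    (hγe : Real.sqrt γ ≤ Real.exp (1 - (𝔠.p₀ + 𝔠.r₀))) (K n k : ℕ) (hk : K - n = k + 1) (hkK : k + 1 ≤ K)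
    (X : (tsys 3 (nblkOf (SK F 𝔠 γ hγ hγ1 K) 𝔠.lane.carrier k)).Dom)
    (W : GaugeField (F.P K) (k + 1) (Matrix.specialUnitaryGroup (Fin 2) ℂ)) (W' : GaugeField (F.P (K + 1)) (k + 1 + 1) (Matrix.specialUnitaryGroup (Fin 2) ℂ)) :
    |((q (K + 1)).𝔄.Λc (k + 1)).far (domCast (nblkOf_succ_eq (hγ := hγ) (hγ1 := hγ1) K k) X) (Hist.triv (F.P (K + 1)) (k + 1 + 1)) W' -
        ((q K).𝔄.Λc k).far X (Hist.triv (F.P K) (k + 1)) W| ≤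
      2 * (𝔠.Cfar * 𝔠.C63) * Real.exp (-κ₁ * (tsys 3 (nblkOf (SK F 𝔠 γ hγ hγ1 K) 𝔠.lane.carrier k)).dj X) *
        θBal F.L γ 𝔠.b₀ (𝔠.p₀ + 𝔠.r₀) n ^ 7 := by
  have hL : 1 ≤ F.L := F.hL.2.le
  have hγ1' : γ ≤ 1 := hγ1.trans (sq_min_one_le _ 𝔠.gamma0_pos)
  have hKk : K - k = n + 1 := by omega
  have h1 := abs_farΛ_succ_le q K k hkK X W'
  have h0 := abs_farΛ_le q K k hkK X W
  rw [hKk] at h0 h1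
  set d : ℝ := (tsys 3 (nblkOf (SK F 𝔠 γ hγ hγ1 K) 𝔠.lane.carrier k)).dj X with hddef
  have hd : 0 ≤ d := (tsys 3 (nblkOf (SK F 𝔠 γ hγ hγ1 K) 𝔠.lane.carrier k)).dj_nonneg X
  have hexp : Real.exp (-(𝔠.κ * d)) ≤ Real.exp (-κ₁ * d) := Real.exp_le_exp.mpr (by nlinarith)
  have hp' : 0 ≤ 𝔠.p₀ + 𝔠.r₀ := by linarith [𝔠.p₀_pos, 𝔠.one_le_r₀]
  have hθ0 : 0 ≤ θBal F.L γ 𝔠.b₀ (𝔠.p₀ + 𝔠.r₀) (n + 1) := (T3MinimiserStabilityReduction.θBal_pos hL hγ hγ1' 𝔠.b₀_pos _ (n + 1)).le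
  have hθ : θBal F.L γ 𝔠.b₀ (𝔠.p₀ + 𝔠.r₀) (n + 1) ^ 7 ≤ θBal F.L γ 𝔠.b₀ (𝔠.p₀ + 𝔠.r₀) n ^ 7 :=
    pow_le_pow_left₀ hθ0 (θBal_succ_le hL hγ hγ1' hγe 𝔠.b₀_pos.le hp' n) 7
  have hA : 0 ≤ 𝔠.Cfar * 𝔠.C63 := mul_nonneg 𝔠.Cfar_nonneg (((q K).𝔄.Λc k).amplitude_nonneg X)
  have hone : 𝔠.Cfar * 𝔠.C63 * Real.exp (-(𝔠.κ * d)) * θBal F.L γ 𝔠.b₀ (𝔠.p₀ + 𝔠.r₀) (n + 1) ^ 7 ≤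
      𝔠.Cfar * 𝔠.C63 * Real.exp (-κ₁ * d) * θBal F.L γ 𝔠.b₀ (𝔠.p₀ + 𝔠.r₀) n ^ 7 :=
    mul_le_mul (mul_le_mul_of_nonneg_left hexp hA) hθ (pow_nonneg hθ0 7) (mul_nonneg hA (Real.exp_pos _).le)
  calc |_ - _| ≤ |((q (K + 1)).𝔄.Λc (k + 1)).far (domCast (nblkOf_succ_eq (hγ := hγ) (hγ1 := hγ1) K k) X) (Hist.triv (F.P (K + 1)) (k + 1 + 1)) W'| +
        |((q K).𝔄.Λc k).far X (Hist.triv (F.P K) (k + 1)) W| := abs_sub _ _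
    _ ≤ _ + _ := add_le_add (h1.trans hone) (h0.trans hone)
    _ = _ := by ring

/-! ## §L3 The Λ-family two-run row at the collar profile from K1a for the Λ-kernels and the configuration Cauchy row -/

/-- Triangle bookkeeping: `|(J′ − f′) − (J − f) − 0| ≤ |J′ − J| + |f′ − f|`. [folklore] -/
theorem abs_jet_far_diff_le (J J' f f' : ℝ) : |J' - f' - (J - f) - 0| ≤ |J' - J| + |f' - f| := by
  rw [sub_zero, show J' - f' - (J - f) = (J' - J) - (f' - f) by ring]
  exact abs_sub _ _

/-- **THE Λ-FAMILY TWO-RUN ROW AT THE COLLAR PROFILE `p₀ + r₀`, FROM K1a FOR THE Λ-KERNELS AND THE CONFIGURATION CAUCHY ROW** (w2 g0's located residual #3, discharged in the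
shifted currency).  For `κ₁ ≤ 𝔠.κ`, `√γ ≤ e^{1−(p₀+r₀)}`, the configuration window `cB·r(g_k)g_kp(g_k) ≤ 1`, `0 ≤ C`, `0 ≤ C_B`: `K1aStepΛ q κ₁ a C` and
`CfgCauchyStepOn S q 𝔠.b₀ (𝔠.p₀ + 𝔠.r₀) a C_B` (the window AT the collar profile) give
`LambdaTermSlackOn S q 𝔠.b₀ (𝔠.p₀ + 𝔠.r₀) κ₁ (θ_{b₀,p₀+r₀}²) a 7 (5·(cB²·C + 6·cB·C_B·C_Λ) + 2·Cfar·C63)`, `C_Λ = C63·(max 1 (12/ρ))⁶`, shift `0`: the jet part by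
`jet_re_diff_ml_transport` at the displayed objects with `bound28`'s size `cB·(r g p) = cB·θ_{p₀+r₀}(n+1)` read AS the collar-profile threshold (no spare coupling is needed or
used), the far part by `abs_farΛ_sub_le`.  The polylogarithm of the g-free family is thus a PROFILE SHIFT, admitted by the crux through
`InteriorExcision.regPrIntL_of_recChi_slackOnChi_higherProfile_allL` (p589812). [cite: King1986, Prop. 3.6 (3.55)-(3.56) p.662, Prop. 3.8 (3.71) p.664; Balaban1985UV3, (28) p.263, (61)-(63) pp.271-272, (57) p.270, (7) p.257] -/
theorem lambdaTermSlackOn_of_k1aΛ_cfgCauchy (S : WinPred F) (q : ∀ K, AlphaInputsT3AC.PkgCoreV3 F 𝔠 γ hγ hγ1 K) {κ₁ a C C_B : ℝ}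
    (hκ₁ : κ₁ ≤ 𝔠.κ) (hγe : Real.sqrt γ ≤ Real.exp (1 - (𝔠.p₀ + 𝔠.r₀))) (hC : 0 ≤ C) (hCB : 0 ≤ C_B)
    (hwin : ∀ K k, k + 1 ≤ K →
      𝔠.cB * (B10.rFun 𝔠.r₀ ((SK F 𝔠 γ hγ hγ1 K).gk k) * (SK F 𝔠 γ hγ hγ1 K).gk k * B10.pFun 𝔠.b₀ 𝔠.p₀ ((SK F 𝔠 γ hγ hγ1 K).gk k)) ≤ 1)
    (hK : K1aStepΛ q κ₁ a C) (hB : CfgCauchyStepOn S q 𝔠.b₀ (𝔠.p₀ + 𝔠.r₀) a C_B) :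
    LambdaTermSlackOn S q 𝔠.b₀ (𝔠.p₀ + 𝔠.r₀) κ₁ (fun n => θBal F.L γ 𝔠.b₀ (𝔠.p₀ + 𝔠.r₀) n ^ 2) a 7
      (5 * (𝔠.cB ^ 2 * C + 6 * 𝔠.cB * C_B * (𝔠.C63 * (max 1 (12 / 𝔠.ρ)) ^ 6)) + 2 * (𝔠.Cfar * 𝔠.C63)) := by
  have hL : 1 ≤ F.L := F.hL.2.le
  have hL1 : (1 : ℝ) ≤ (F.L : ℝ) := by exact_mod_cast hL
  have hγ1' : γ ≤ 1 := hγ1.trans (sq_min_one_le _ 𝔠.gamma0_pos)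
  have hcB := 𝔠.cB_nonneg
  set C_E : ℝ := 𝔠.C63 * (max 1 (12 / 𝔠.ρ)) ^ 6 with hCEdef
  refine ⟨fun _ _ _ => 0, fun K n hn k hk V hV hS hS' X hX => ?_⟩
  have hkK : k + 1 ≤ K := by omega
  have hKk : K - k = n + 1 := by omega
  have hCE : 0 ≤ C_E := by have := ((q K).𝔄.Λc k).amplitude_nonneg X; positivity
  -- letters
  let g : ℝ := (SK F 𝔠 γ hγ hγ1 K).gk k
  let pg : ℝ := B10.pFun 𝔠.b₀ 𝔠.p₀ g
  let r : ℝ := B10.rFun 𝔠.r₀ g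
  let d₀ : ℝ := (tsys 3 (nblkOf (SK F 𝔠 γ hγ hγ1 K) 𝔠.lane.carrier k)).dj X
  let e₀ : ℝ := Real.exp (-(𝔠.κ * d₀))
  let e₁ : ℝ := Real.exp (-κ₁ * d₀)
  let ρ : ℝ := (((F.L : ℝ) ^ (1 + k))⁻¹) ^ a
  let θ' : ℝ := r * g * pg
  have hg0 : 0 < g := gk_pos _ k
  have hg1 : g ≤ 1 := gk_le_one _ (SK F 𝔠 γ hγ hγ1 K).gK_le_one k (by show k ≤ K; omega)
  have hpg0 : 0 ≤ pg := B10.pFun_nonneg _ _ _ 𝔠.b₀_pos.le hg0 hg1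
  have hr0 : 0 ≤ r := by
    show 0 ≤ B10.rFun 𝔠.r₀ g
    unfold B10.rFun; exact Real.rpow_nonneg (by linarith [B10.log_inv_nonneg_of_le_one hg0 hg1]) _
  have hd₀ : 0 ≤ d₀ := (tsys 3 (nblkOf (SK F 𝔠 γ hγ hγ1 K) 𝔠.lane.carrier k)).dj_nonneg X
  have he₁ : 0 ≤ e₁ := (Real.exp_pos _).le
  have he01 : e₀ ≤ e₁ := Real.exp_le_exp.mpr (by nlinarith)
  have hx0 : 0 ≤ ((F.L : ℝ) ^ (1 + k))⁻¹ := by positivity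
  have hρ0 : 0 ≤ ρ := Real.rpow_nonneg hx0 _
  have hθ'0 : 0 ≤ θ' := by positivity
  have hsθ : 𝔠.cB * θ' ≤ 1 := hwin K k hkK
  -- `θ' = θ_{p₀+r₀}(n+1) ≤ θ_{p₀+r₀}(n)`
  have hθ'eq : θ' = θBal F.L γ 𝔠.b₀ (𝔠.p₀ + 𝔠.r₀) (n + 1) := by
    show B10.rFun 𝔠.r₀ g * g * B10.pFun 𝔠.b₀ 𝔠.p₀ g = _
    rw [rFun_mul_mul_pFun hg0 hg1, ← hKk, show g = (SK F 𝔠 γ hγ hγ1 K).gk k from rfl, SK, T3Scales_gk_eq F γ hγ _ K k (by omega),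
      ← T3Thresholds.θBal_eq]
  have hp' : 0 ≤ 𝔠.p₀ + 𝔠.r₀ := by linarith [𝔠.p₀_pos, 𝔠.one_le_r₀]
  have hθn : θ' ^ 2 ≤ θBal F.L γ 𝔠.b₀ (𝔠.p₀ + 𝔠.r₀) n ^ 2 := by
    rw [hθ'eq]
    exact pow_le_pow_left₀ (T3MinimiserStabilityReduction.θBal_pos hL hγ hγ1' 𝔠.b₀_pos _ (n + 1)).le
      (θBal_succ_le hL hγ hγ1' hγe 𝔠.b₀_pos.le hp' n) 2
  -- the objects
  let T := transport ↥(lieC (suGroupModel 2)) F K k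
  let Λ₀ := lambdaChartAt q K k X
  let Λ₁ := lambdaChartAt q (K + 1) (k + 1) (domCast (nblkOf_succ_eq (hγ := hγ) (hγ1 := hγ1) K k) X)
  let W : GaugeField (F.P K) (k + 1) (Matrix.specialUnitaryGroup (Fin 2) ℂ) :=
    fieldShift (F.sitesPerDir_eq (m := F.m) (K := K) (j := k + 1) (m' := F.m) (K' := n) (j' := 0) (by omega)) V
  let W' : GaugeField (F.P (K + 1)) (k + 1 + 1) (Matrix.specialUnitaryGroup (Fin 2) ℂ) :=
    fieldShift (F.sitesPerDir_eq (m := F.m) (K := K + 1) (j := k + 1 + 1) (m' := F.m) (K' := n) (j' := 0) (by omega)) V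
  let B₀ := cfgAt q K k X W
  let B₁' := cfgAt q (K + 1) (k + 1) (domCast (nblkOf_succ_eq (hγ := hγ) (hγ1 := hγ1) K k) X) W'
  let B₁ : PBond (F.P K) k → ↥(lieC (suGroupModel 2)) := fun c => B₁' (matchBond F K k c)
  have hTB₁ : transport ↥(lieC (suGroupModel 2)) F K k B₁ = B₁' := transport_pullback K k B₁'
  -- the five object hypotheses
  have h₁ : ‖B₀‖ ≤ 𝔠.cB * θ' * 1 ^ 2 := by
    rw [one_pow, mul_one]; exact ((q K).runCore.steps k hkK).bound28 X (Hist.triv (F.P K) (k + 1)) W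
  have h₂ : ‖B₁‖ ≤ 𝔠.cB * θ' * 1 ^ 2 := by
    rw [one_pow, mul_one]
    have h0 := ((q (K + 1)).runCore.steps (k + 1) (show k + 1 + 1 ≤ K + 1 by omega)).bound28
      (domCast (nblkOf_succ_eq (hγ := hγ) (hγ1 := hγ1) K k) X) (Hist.triv (F.P (K + 1)) (k + 1 + 1)) W'
    rw [gk_succ_eq (hγ := hγ) (hγ1 := hγ1) K k (by omega)] at h0
    exact (norm_pullback_le K k B₁').trans h0
  have h₃ : ‖B₁ - B₀‖ ≤ C_B * θ' * 1 ^ 2 * ρ := by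
    rw [one_pow, mul_one]
    exact hB K n hn k hk V hV hS hS' X hX
  have h₅ : ∀ d ∈ Finset.Ico 2 7, ‖iteratedFDeriv ℂ d Λ₀ 0‖ ≤ C_E * e₁ := fun d hd => by
    have hd6 : d ≤ 6 := by have := (Finset.mem_Ico.mp hd).2; omega
    exact (norm_kernelΛ_le_of_chart q K k X hd6).trans (mul_le_mul_of_nonneg_left he01 hCE)
  have h₄ : ∀ d ∈ Finset.Ico 2 7, ‖(iteratedFDeriv ℂ d Λ₁ 0).compContinuousLinearMap (fun _ => T) - iteratedFDeriv ℂ d Λ₀ 0‖ ≤ C * e₁ * ρ :=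
    fun d hd => hK K k hkK X hX d hd
  -- restate the goal in the displayed-object vocabulary (definitional)
  show |(jet26 Λ₁ B₁').re - ((q (K + 1)).𝔄.Λc (k + 1)).far (domCast (nblkOf_succ_eq (hγ := hγ) (hγ1 := hγ1) K k) X) (Hist.triv (F.P (K + 1)) (k + 1 + 1)) W' -
      ((jet26 Λ₀ B₀).re - ((q K).𝔄.Λc k).far X (Hist.triv (F.P K) (k + 1)) W) - 0| ≤
    (5 * (𝔠.cB ^ 2 * C + 6 * 𝔠.cB * C_B * C_E) + 2 * (𝔠.Cfar * 𝔠.C63)) * e₁ * (θBal F.L γ 𝔠.b₀ (𝔠.p₀ + 𝔠.r₀) n ^ 2 * ρ + θBal F.L γ 𝔠.b₀ (𝔠.p₀ + 𝔠.r₀) n ^ 7)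
  -- the jet part (lane A's algebra at the transport) and the far part
  have key := jet_re_diff_ml_transport K k Λ₀ Λ₁ B₀ B₁ (θ := θ') (x := 1) (ρ := ρ) (e := e₁) (C := C) (C_E := C_E) (C_s := 𝔠.cB) (C_B := C_B)
    hθ'0 hsθ zero_le_one le_rfl hρ0 he₁ hC hCE hcB hCB h₁ h₂ h₃ h₄ h₅
  rw [hTB₁] at key
  have hfar := abs_farΛ_sub_le q hκ₁ hγe K n k hk hkK X W W'
  refine (abs_jet_far_diff_le _ _ _ _).trans ?_
  refine (add_le_add key hfar).trans ?_
  -- scalar bookkeeping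
  have hJ0 : 0 ≤ 5 * (𝔠.cB ^ 2 * C + 6 * 𝔠.cB * C_B * C_E) := by positivity
  have hF0 : 0 ≤ 2 * (𝔠.Cfar * 𝔠.C63) := by
    have := mul_nonneg 𝔠.Cfar_nonneg (((q K).𝔄.Λc k).amplitude_nonneg X); linarith
  have hθ7 : 0 ≤ θBal F.L γ 𝔠.b₀ (𝔠.p₀ + 𝔠.r₀) n ^ 7 := pow_nonneg (T3MinimiserStabilityReduction.θBal_pos hL hγ hγ1' 𝔠.b₀_pos _ n).le 7
  have hθ2ρ : 0 ≤ θBal F.L γ 𝔠.b₀ (𝔠.p₀ + 𝔠.r₀) n ^ 2 * ρ := mul_nonneg (sq_nonneg _) hρ0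
  have hjet : 5 * (𝔠.cB ^ 2 * C + 6 * 𝔠.cB * C_B * C_E) * e₁ * 1 ^ 4 * (θ' ^ 2 * ρ) ≤
      5 * (𝔠.cB ^ 2 * C + 6 * 𝔠.cB * C_B * C_E) * e₁ * (θBal F.L γ 𝔠.b₀ (𝔠.p₀ + 𝔠.r₀) n ^ 2 * ρ + θBal F.L γ 𝔠.b₀ (𝔠.p₀ + 𝔠.r₀) n ^ 7) := by
    rw [one_pow, mul_one]
    refine mul_le_mul_of_nonneg_left ?_ (mul_nonneg hJ0 he₁)
    exact (mul_le_mul_of_nonneg_right hθn hρ0).trans (le_add_of_nonneg_right hθ7)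
  have hfar' : 2 * (𝔠.Cfar * 𝔠.C63) * e₁ * θBal F.L γ 𝔠.b₀ (𝔠.p₀ + 𝔠.r₀) n ^ 7 ≤
      2 * (𝔠.Cfar * 𝔠.C63) * e₁ * (θBal F.L γ 𝔠.b₀ (𝔠.p₀ + 𝔠.r₀) n ^ 2 * ρ + θBal F.L γ 𝔠.b₀ (𝔠.p₀ + 𝔠.r₀) n ^ 7) :=
    mul_le_mul_of_nonneg_left (le_add_of_nonneg_left hθ2ρ) (mul_nonneg hF0 he₁)
  calc 5 * (𝔠.cB ^ 2 * C + 6 * 𝔠.cB * C_B * C_E) * e₁ * 1 ^ 4 * (θ' ^ 2 * ρ) +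
        2 * (𝔠.Cfar * 𝔠.C63) * Real.exp (-κ₁ * (tsys 3 (nblkOf (SK F 𝔠 γ hγ hγ1 K) 𝔠.lane.carrier k)).dj X) * θBal F.L γ 𝔠.b₀ (𝔠.p₀ + 𝔠.r₀) n ^ 7
      ≤ 5 * (𝔠.cB ^ 2 * C + 6 * 𝔠.cB * C_B * C_E) * e₁ * (θBal F.L γ 𝔠.b₀ (𝔠.p₀ + 𝔠.r₀) n ^ 2 * ρ + θBal F.L γ 𝔠.b₀ (𝔠.p₀ + 𝔠.r₀) n ^ 7) +
          2 * (𝔠.Cfar * 𝔠.C63) * e₁ * (θBal F.L γ 𝔠.b₀ (𝔠.p₀ + 𝔠.r₀) n ^ 2 * ρ + θBal F.L γ 𝔠.b₀ (𝔠.p₀ + 𝔠.r₀) n ^ 7) := add_le_add hjet hfar'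
    _ = _ := by ring

end Summit.QuantumFields.YangMills.Theorems.GlobalSlackCanonicalPolymers

end
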